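import Mathlib
import Summits.BirchSwinnertonDyer.BirchSwinnertonDyer.Theorems.ResidualThetaTransportAtTwoSignedMuSeedAtTwoPlusNonsquareDescentUnitsModUniversalNorms
import HarnessLib

/-!
# Non-square descent — THE COHERENT-SEQUENCE MODEL of the norm-coherent limit `Ē = lim_← E_j`: it is complete (`hlift`) for free, so
# `…UnitsModUniversalNorms.natCard_quotient_range_proj_le` applies to it verbatim (line `nonsquare-descent`, stub S2 residue
# «`[𝓔_n^χ : 𝒩_n] ≤ #F^χ`») — seed crux `SignedMuSeedAtTwoPlus` stmt-BirchSwinnertonDyer-21438 (parent Kμ⁺ `SignedMuVanishingAtTwoPlus`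
# stmt-BirchSwinnertonDyer-20689, route ResidualThetaTransportAtTwo), line card `Cruxes/SignedMuSeedAtTwoPlus/Lines/nonsquare-descent.md`

Cell `bsd-wall`, width seat `bsd-wall-rtt-p4-w2` g19 (`--supports`, closes nothing).  THEOREMS ONLY; BSD is not proved by this and nothing
arithmetic is asserted.

`…UnitsModUniversalNorms` takes the limit `E_∞` abstractly: projections `π i : E_∞ → E i` with `N i ∘ π (i+1) = π i` and COMPLETENESS `hlift` (every
norm-coherent sequence is realised).  The canonical model — the submodule `S ≤ Π_i E i` of norm-coherent sequences with `π i = proj_i|_S` (g18's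
`…LimitBookkeeping` §3 reading of `Ē^χ` as «coherent sequences in `Π 𝓔_n^χ ⊗ ℤ₂`») — satisfies both for free:

* `exists_coherent_submodule` — the coherent sequences form a submodule `S` (characterised by `x ∈ S ↔ ∀ i, N i (x (i+1)) = x i`; no `def`);
* `proj_coherent_compat`, `proj_coherent_lift` — `hπ` and `hlift` for `π i = (LinearMap.proj i) ∘ S.subtype`;
* `mem_range_proj_coherent_iff` — `range π_0 = {x₀ | ∃ coherent x, x 0 = x₀}`;
* **`natCard_quotient_range_proj_coherent_le`** — `…UnitsModUniversalNorms.natCard_quotient_range_proj_le` for this model: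
  levelwise `H¹`-indices `≤ K` ⟹ `#(E_0 ⧸ range π_0) ≤ K`, finite.

[folklore]
-/

set_option autoImplicit false
-- the Theorems namespace of this sub repeats the summit name by design (D-0017 nested layout)
set_option linter.dupNamespace false

open scoped Pointwise nonZeroDivisors
open Literature.Algebra.Homology

namespace Summit.BirchSwinnertonDyer.BirchSwinnertonDyer.Theorems.SignedMuAtTwo.NonsquareDescent

universe u v

variable {R : Type u} [CommRing R] (E : ℕ → Type v) [∀ i, AddCommGroup (E i)] [∀ i, Module R (E i)]
  (N : ∀ i, E (i + 1) →ₗ[R] E i)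

/-- **The norm-coherent sequences form a submodule of `Π_i E i`.** [folklore] -/
theorem exists_coherent_submodule :
    ∃ S : Submodule R (∀ i, E i), ∀ x : ∀ i, E i, x ∈ S ↔ ∀ i, N i (x (i + 1)) = x i := by
  refine ⟨{ carrier := {x | ∀ i, N i (x (i + 1)) = x i}
            add_mem' := fun {x y} hx hy i => by rw [Pi.add_apply, Pi.add_apply, map_add, hx i, hy i]
            zero_mem' := fun i => by rw [Pi.zero_apply, Pi.zero_apply, map_zero]
            smul_mem' := fun c x hx i => by rw [Pi.smul_apply, Pi.smul_apply, map_smul, hx i] }, fun x => Iff.rfl⟩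

variable {E N}
variable {S : Submodule R (∀ i, E i)} (hS : ∀ x : ∀ i, E i, x ∈ S ↔ ∀ i, N i (x (i + 1)) = x i)
include hS

/-- `hπ`: the projections of the coherent-sequence model are compatible. [folklore] -/
theorem proj_coherent_compat (i : ℕ) (e : S) :
    N i (((LinearMap.proj (i + 1) : (∀ j, E j) →ₗ[R] E (i + 1)) ∘ₗ S.subtype) e) =
      ((LinearMap.proj i : (∀ j, E j) →ₗ[R] E i) ∘ₗ S.subtype) e := by
  rw [LinearMap.comp_apply, LinearMap.comp_apply, Submodule.subtype_apply, LinearMap.proj_apply, LinearMap.proj_apply]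
  exact (hS e.1).1 e.2 i

/-- `hlift`: every norm-coherent sequence is realised by the coherent-sequence model (completeness for free). [folklore] -/
theorem proj_coherent_lift (x : ∀ i, E i) (hx : ∀ i, N i (x (i + 1)) = x i) :
    ∃ e : S, ∀ i, ((LinearMap.proj i : (∀ j, E j) →ₗ[R] E i) ∘ₗ S.subtype) e = x i :=
  ⟨⟨x, (hS x).2 hx⟩, fun _ => rfl⟩

/-- `range π_0` of the model = the `0`-th terms of norm-coherent sequences. [folklore] -/
theorem mem_range_proj_coherent_iff (x₀ : E 0) :
    x₀ ∈ LinearMap.range ((LinearMap.proj 0 : (∀ j, E j) →ₗ[R] E 0) ∘ₗ S.subtype) ↔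
      ∃ x : ∀ i, E i, x 0 = x₀ ∧ ∀ i, N i (x (i + 1)) = x i :=
  mem_range_proj_iff E N (fun i => (LinearMap.proj i : (∀ j, E j) →ₗ[R] E i) ∘ₗ S.subtype)
    (proj_coherent_compat hS) (proj_coherent_lift hS) x₀

/-- **UNITS MODULO UNIVERSAL NORMS for the coherent-sequence model: `#(E_0 ⧸ range π_0) ≤ K`, finite** — the hypotheses are those of
`…UnitsModUniversalNorms.natCard_quotient_range_proj_le` minus `hπ`/`hlift` (automatic here): composites `Nc`, Galois-descent inclusions
`ι j` with `ι j ∘ Nc j 0 = ν j •`, the Freeness data of every level (stub S1), `I`-adically complete levels with finite truncations, and the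
levelwise `H¹`-bounds `(E_j[ν_j] : ωE_j) ≤ K`. [folklore] -/
theorem natCard_quotient_range_proj_coherent_le (Nc : ∀ j i, E j →ₗ[R] E i) (I : Ideal R) [∀ i, IsAdicComplete I (E i)]
    (hfin : ∀ i k, Finite (E i ⧸ (I ^ k • ⊤ : Submodule R (E i))))
    (hNc0 : ∀ j, Nc j j = LinearMap.id) (hNcS : ∀ j i, i ≤ j → Nc (j + 1) i = Nc j i ∘ₗ N j)
    {ω : R} (hω : ω ∈ R⁰) (ν : ℕ → R) (hν : ∀ j, ν j ∈ R⁰) (hE : ∀ j (x : E j), (ν j * ω) • x = 0)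
    (u : ∀ j, E j) (hu : ∀ j (r : R), r • u j = 0 → ν j * ω ∣ r) (hfu : ∀ j, Finite (E j ⧸ Submodule.span R {u j}))
    (ι : ∀ j, E 0 →ₗ[R] E j) (hι : ∀ j, Function.Injective (ι j)) (hιω : ∀ j (x : E 0), ω • ι j x = 0)
    (hιr : ∀ j (e : E j), ω • e = 0 → e ∈ LinearMap.range (ι j)) (hιN : ∀ j (x : E j), ι j (Nc j 0 x) = ν j • x)
    (K : ℕ) (hK : ∀ j, Herbrand.index (Submodule.torsionBy R (E j) (ν j)) (ω • (⊤ : Submodule R (E j))) ≤ K) :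
    Nat.card (E 0 ⧸ LinearMap.range ((LinearMap.proj 0 : (∀ j, E j) →ₗ[R] E 0) ∘ₗ S.subtype)) ≤ K ∧
      Nat.card (E 0 ⧸ LinearMap.range ((LinearMap.proj 0 : (∀ j, E j) →ₗ[R] E 0) ∘ₗ S.subtype)) ≠ 0 :=
  natCard_quotient_range_proj_le E N Nc (fun i => (LinearMap.proj i : (∀ j, E j) →ₗ[R] E i) ∘ₗ S.subtype) I hfin hNc0 hNcS
    (proj_coherent_compat hS) (proj_coherent_lift hS) hω ν hν hE u hu hfu ι hι hιω hιr hιN K hK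

end Summit.BirchSwinnertonDyer.BirchSwinnertonDyer.Theorems.SignedMuAtTwo.NonsquareDescent
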